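import Summits.ValiantsHypothesis.ValiantsHypothesis.Theorems.NewtonTauWeak.Negative.AlignedPeelingEngine
import Summits.ValiantsHypothesis.ValiantsHypothesis.Theorems.NewtonTauWeak.Negative.AlignedPeelingDesign

/-!
# `NewtonTauWeak` (stmt-5904), line `aligned-peeling` refuted — part 4: values, the support of `F`, and the lower
# bound `vert F ≥ n` (negative lane)

The series `Theorems/NewtonTauWeak/Negative/AlignedPeeling*.lean` refutes the load-bearing stub `stub_alignedPeeling`
(`∃ C c, AlignedPeeling C c`) of the registered line `aligned-peeling` of crux `NewtonTauWeak`
(stmt-ValiantsHypothesis-5904); see `AlignedPeelingSumset.lean` for the overview.  The LINE dies; the crux itself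
stays OPEN; nothing here bears on `VP ≠ VNP`.

This file: the value facts of the design family seen from a corner (`fam_cases`, `cval_pos`, the guard gap
`cval_gt_two`, `guard_only_zero`, the chain inequality `chain_lt` and the chain gap `cval_gt_target`), the unique
representations of summits and guards (`coeff_desP_summitPt/guardPt = 1`), hence `support_desF : F.support = sumset ∖ Dels`,
and the exposure of the `n` chain targets at corner `0` (`isUniqueMin_targetPt`), giving `le_vert_desF : n ≤ vert (desF n)`.
[folklore]
-/

set_option linter.dupNamespace false
set_option linter.unusedSimpArgs false

namespace Summit.ValiantsHypothesis.ValiantsHypothesis.Theorems.NewtonTauWeak.Negative.AlignedPeelingCex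

open scoped BigOperators
open MvPolynomial Finset
open Summit.ValiantsHypothesis.ValiantsHypothesis.Theorems.NewtonTauWeak.Negative (vert)

noncomputable section

/-! ## C.4 Values of the family's points -/

/-- The side is positive. -/
theorem side_pos (n : ℕ) : 0 < side n := by unfold side; omega

/-- `X + Y ≤ D` for the family. -/
theorem cXY_le_side' (n : ℕ) (i : Fin (n + 1)) : cX n i + cY n i ≤ side n := by
  have := cXY_le_side n i; omega

/-- The far bound of the family: `D - X_i - Y_i ≥ D - 2 - n²`, and `D - 2 - n² ≥ 3`. -/
theorem far_ge (n : ℕ) (i : Fin (n + 1)) :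
    (side n : ℝ) - 2 - (n : ℝ) ^ 2 ≤ (side n : ℝ) - cX n i - cY n i ∧ (3 : ℝ) ≤ (side n : ℝ) - 2 - (n : ℝ) ^ 2 := by
  have h1 := cXY_le n i
  have h2 := sq_le_side n
  have h1r : (cX n i : ℝ) + cY n i ≤ 2 + (n : ℝ) ^ 2 := by exact_mod_cast h1
  have h2r : (n : ℝ) ^ 2 + 5 ≤ side n := by exact_mod_cast h2
  constructor <;> linarith

/-- Family trichotomy at corner `s` (weights `A, B ≥ 0`): corner, own cone point, or far with
`cval ≥ min(A,B) · (D - 2 - n²)`. -/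
theorem fam_cases (n : ℕ) (s : Fin 3) (A B : ℝ) (hA : 0 ≤ A) (hB : 0 ≤ B) (i : Fin (n + 1))
    (t : Fin 2 →₀ ℕ) (ht : t ∈ Tfam n i) :
    t = corner (side n) s ∨ t = phi (side n) s (cX n i) (cY n i) ∨
      min A B * ((side n : ℝ) - 2 - (n : ℝ) ^ 2) ≤ cval (side n) s A B t := by
  rcases cval_far_or (side n) (cX n i) (cY n i) (cXY_le_side' n i) s A B hA hB t ht with h | h | h
  · exact Or.inl h
  · exact Or.inr (Or.inl h)
  · refine Or.inr (Or.inr (le_trans ?_ h))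
    exact mul_le_mul_of_nonneg_left (far_ge n i).1 (le_min hA hB)

/-- Positivity: with weights `A, B ≥ 1`, every family point other than the corner has positive cone functional. -/
theorem cval_pos (n : ℕ) (s : Fin 3) (A B : ℝ) (hA : 1 ≤ A) (hB : 1 ≤ B) (i : Fin (n + 1))
    (t : Fin 2 →₀ ℕ) (ht : t ∈ Tfam n i) (hne : t ≠ corner (side n) s) : 0 < cval (side n) s A B t := by
  rcases fam_cases n s A B (by linarith) (by linarith) i t ht with h | h | h
  · exact absurd h hne
  · rw [h, cval_phi_self _ _ _ _ _ _ (cXY_le_side' n i)]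
    have hX : (1 : ℝ) ≤ cX n i := by exact_mod_cast one_le_cX n i
    have hY : (1 : ℝ) ≤ cY n i := by exact_mod_cast one_le_cY n i
    nlinarith
  · have hm : (1 : ℝ) ≤ min A B := le_min hA hB
    nlinarith [(far_ge n i).2]

/-- Guard gap (weights `(1,1)`): every family point other than the corner and the guard point `φ_s(1,1)` has cone
functional `> 2` (the guard's value). -/
theorem cval_gt_two (n : ℕ) (s : Fin 3) (i : Fin (n + 1)) (t : Fin 2 →₀ ℕ) (ht : t ∈ Tfam n i)
    (hc : t ≠ corner (side n) s) (hg : t ≠ phi (side n) s 1 1) : 2 < cval (side n) s 1 1 t := by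
  rcases fam_cases n s 1 1 zero_le_one zero_le_one i t ht with h | h | h
  · exact absurd h hc
  · by_cases hi : (i : ℕ) = 0
    · exfalso; apply hg; rw [h]; simp [cX, cY, hi]
    · rw [h, cval_phi_self _ _ _ _ _ _ (cXY_le_side' n i)]
      have hX : (1 : ℝ) ≤ cX n i := by exact_mod_cast one_le_cX n i
      have hY : (2 : ℝ) ≤ cY n i := by exact_mod_cast two_le_cY n i hi
      linarith
  · rw [min_self] at h; linarith [(far_ge n i).2]

/-- The guard's own value is `2`. -/
theorem cval_guard (n : ℕ) (s : Fin 3) : cval (side n) s 1 1 (phi (side n) s 1 1) = 2 := by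
  have h : 1 + 1 ≤ side n := by have := sq_le_side n; omega
  rw [cval_phi_self _ _ _ _ _ _ h]; norm_num

/-- The guard point is not the corner. -/
theorem guard_ne_corner (n : ℕ) (s : Fin 3) : phi (side n) s 1 1 ≠ corner (side n) s := by
  intro h
  have := cval_guard n s
  rw [h, cval_corner_self] at this
  norm_num at this

/-- Only the guard factor `i = 0` contains the guard point. -/
theorem guard_only_zero (n : ℕ) (s : Fin 3) (i : Fin (n + 1)) (h : phi (side n) s 1 1 ∈ Tfam n i) : i = 0 := by
  rcases fam_cases n s 1 1 zero_le_one zero_le_one i _ h with h' | h' | h'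
  · exact absurd h' (guard_ne_corner n s)
  · by_contra hi
    have hi' : (i : ℕ) ≠ 0 := fun h0 => hi (Fin.ext h0)
    have hv := congrArg (cval (side n) s 1 1) h'
    rw [cval_guard, cval_phi_self _ _ _ _ _ _ (cXY_le_side' n i)] at hv
    have hX : (1 : ℝ) ≤ cX n i := by exact_mod_cast one_le_cX n i
    have hY : (2 : ℝ) ≤ cY n i := by exact_mod_cast two_le_cY n i hi'
    linarith
  · rw [cval_guard, min_self] at h'; linarith [(far_ge n i).2]

/-- The chain inequality: with weights `(2j+1, 2n-2j+1)` the functional over the chain data is uniquely minimised at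
`j` (`value(m) - value(j) = 2(m-j)((m+j)(n+1) - n(2j+1)) > 0`). -/
theorem chain_lt (n : ℕ) (i j : Fin (n + 1)) (hi : (i : ℕ) ≠ 0) (hj : (j : ℕ) ≠ 0) (hij : i ≠ j) :
    (2 * (j : ℝ) + 1) * (cX n j : ℝ) + (2 * (n : ℝ) - 2 * j + 1) * (cY n j : ℝ) <
      (2 * (j : ℝ) + 1) * (cX n i : ℝ) + (2 * (n : ℝ) - 2 * j + 1) * (cY n i : ℝ) := by
  have hin : (i : ℕ) ≤ n := Nat.lt_succ_iff.mp i.isLt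
  have hjn : (j : ℕ) ≤ n := Nat.lt_succ_iff.mp j.isLt
  unfold cX cY
  rw [if_neg hi, if_neg hi, if_neg hj, if_neg hj]
  push_cast [Nat.cast_sub hin, Nat.cast_sub hjn]
  have hij' : (i : ℕ) ≠ (j : ℕ) := fun h => hij (Fin.ext h)
  set a : ℝ := ((i : ℕ) : ℝ) with ha
  set b : ℝ := ((j : ℕ) : ℝ) with hb
  set m : ℝ := (n : ℝ) with hm
  have hbm : b ≤ m := by rw [hb, hm]; exact_mod_cast hjn
  have ha0 : 0 ≤ a := by rw [ha]; positivity
  have key : (2 * b + 1) * (1 + (m - a) ^ 2) + (2 * m - 2 * b + 1) * (1 + a ^ 2) -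
      ((2 * b + 1) * (1 + (m - b) ^ 2) + (2 * m - 2 * b + 1) * (1 + b ^ 2)) =
      2 * (a - b) * ((a + b) * (m + 1) - m * (2 * b + 1)) := by ring
  rcases lt_or_gt_of_ne hij' with hlt | hgt
  · -- a < b: both factors negative
    have hab : a + 1 ≤ b := by rw [ha, hb]; exact_mod_cast hlt
    have h1 : a - b < 0 := by linarith
    have h2 : (a + b) * (m + 1) - m * (2 * b + 1) < 0 := by nlinarith
    nlinarith [mul_pos_of_neg_of_neg h1 h2]
  · have hab : b + 1 ≤ a := by rw [ha, hb]; exact_mod_cast hgt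
    have h1 : 0 < a - b := by linarith
    have h2 : 0 < (a + b) * (m + 1) - m * (2 * b + 1) := by nlinarith
    nlinarith [mul_pos h1 h2]

/-- The target value is below the far threshold: `(2j+1) X_j + (2n-2j+1) Y_j < D - 2 - n²`. -/
theorem vq_lt_far (n : ℕ) (j : Fin (n + 1)) (hj : (j : ℕ) ≠ 0) :
    (2 * (j : ℝ) + 1) * (cX n j : ℝ) + (2 * (n : ℝ) - 2 * j + 1) * (cY n j : ℝ) <
      (side n : ℝ) - 2 - (n : ℝ) ^ 2 := by
  have hjn : (j : ℕ) ≤ n := Nat.lt_succ_iff.mp j.isLt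
  have hn1 : 1 ≤ n := le_trans (Nat.pos_of_ne_zero hj) hjn
  have hsum : (cX n j : ℝ) + cY n j ≤ 2 + (n : ℝ) ^ 2 := by exact_mod_cast cXY_le n j
  have hX : (0 : ℝ) ≤ cX n j := by positivity
  have hY : (0 : ℝ) ≤ cY n j := by positivity
  have hjr : (j : ℝ) ≤ n := by exact_mod_cast hjn
  have hj0 : (0 : ℝ) ≤ j := by positivity
  have hnr : (1 : ℝ) ≤ n := by exact_mod_cast hn1
  have hA : 2 * (j : ℝ) + 1 ≤ 2 * n + 1 := by linarith
  have hB : 2 * (n : ℝ) - 2 * j + 1 ≤ 2 * n + 1 := by linarith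
  have hside : (side n : ℝ) = 16 * (n : ℝ) ^ 3 + 16 := by unfold side; push_cast; ring
  calc (2 * (j : ℝ) + 1) * (cX n j : ℝ) + (2 * (n : ℝ) - 2 * j + 1) * (cY n j : ℝ)
      ≤ (2 * n + 1) * (cX n j : ℝ) + (2 * n + 1) * (cY n j : ℝ) := by
        nlinarith [mul_le_mul_of_nonneg_right hA hX, mul_le_mul_of_nonneg_right hB hY]
    _ = (2 * n + 1) * ((cX n j : ℝ) + cY n j) := by ring
    _ ≤ (2 * n + 1) * (2 + (n : ℝ) ^ 2) := mul_le_mul_of_nonneg_left hsum (by linarith)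
    _ < (side n : ℝ) - 2 - (n : ℝ) ^ 2 := by
        rw [hside]; nlinarith [pow_le_pow_left₀ (by linarith : (0:ℝ) ≤ 1) hnr 3,
          mul_le_mul_of_nonneg_left hnr (by positivity : (0:ℝ) ≤ (n:ℝ)^2)]

/-- Chain gap (weights `(2j+1, 2n-2j+1)`, `j ≠ 0`): every family point other than the corner, the guard point and
the target `φ_s(X_j, Y_j)` has cone functional above the target's value. -/
theorem cval_gt_target (n : ℕ) (s : Fin 3) (j : Fin (n + 1)) (hj : (j : ℕ) ≠ 0) (i : Fin (n + 1))
    (t : Fin 2 →₀ ℕ) (ht : t ∈ Tfam n i) (hc : t ≠ corner (side n) s) (hg : t ≠ phi (side n) s 1 1)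
    (hq : t ≠ phi (side n) s (cX n j) (cY n j)) :
    (2 * (j : ℝ) + 1) * (cX n j : ℝ) + (2 * (n : ℝ) - 2 * j + 1) * (cY n j : ℝ) <
      cval (side n) s (2 * (j : ℝ) + 1) (2 * (n : ℝ) - 2 * j + 1) t := by
  have hjn : (j : ℕ) ≤ n := Nat.lt_succ_iff.mp j.isLt
  have hjr : (j : ℝ) ≤ n := by exact_mod_cast hjn
  have hj0 : (0 : ℝ) ≤ j := by positivity
  have hA : (1 : ℝ) ≤ 2 * (j : ℝ) + 1 := by linarith
  have hB : (1 : ℝ) ≤ 2 * (n : ℝ) - 2 * j + 1 := by linarith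
  rcases fam_cases n s (2 * (j : ℝ) + 1) (2 * (n : ℝ) - 2 * j + 1) (by linarith) (by linarith) i t ht with
    h | h | h
  · exact absurd h hc
  · by_cases hi : (i : ℕ) = 0
    · exfalso; apply hg; rw [h]; simp [cX, cY, hi]
    · by_cases hij : i = j
      · subst hij; exact absurd h hq
      · rw [h, cval_phi_self _ _ _ _ _ _ (cXY_le_side' n i)]
        exact chain_lt n i j hi hj hij
  · have hm : (1 : ℝ) ≤ min (2 * (j : ℝ) + 1) (2 * (n : ℝ) - 2 * j + 1) := le_min hA hB
    have hfar := vq_lt_far n j hj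
    nlinarith [(far_ge n i).2, (far_ge n j).2]

/-! ## C.5 Unique representations, the support of `F` -/

/-- `fv` form of the cone functional facts: the difference `fv t - fv c_s`. -/
theorem fv_sub_eq_cval (D : ℕ) (s : Fin 3) (A B : ℝ) (t : Fin 2 →₀ ℕ) :
    fv (xi0 s A B) (xi1 s A B) t - fv (xi0 s A B) (xi1 s A B) (corner D s) = cval D s A B t := (cval_eq D s A B t).symm

/-- The summit has coefficient `1` in `P`. -/
theorem coeff_desP_summitPt (n : ℕ) (s : Fin 3) : coeff (summitPt n s) (desP n) = 1 := by
  unfold desP summitPt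
  refine coeff_prod_onesPoly_eq_one (Tfam n) _ (fun _ => corner (side n) s) (fun i => corner_mem_Tgen _ _ _ s)
    (by simp) fun f hf hsum => ?_
  refine rep_summit_unique (Tfam n) (corner (side n) s) (xi0 s 1 1) (xi1 s 1 1) (fun i t ht hne => ?_) f hf
    (by simpa using hsum)
  have := cval_pos n s 1 1 le_rfl le_rfl i t ht hne
  rw [← fv_sub_eq_cval] at this; linarith

/-- The guard point has coefficient `1` in `P`. -/
theorem coeff_desP_guardPt (n : ℕ) (s : Fin 3) : coeff (guardPt n s) (desP n) = 1 := by
  classical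
  unfold desP
  have hrepr : ∑ i, Function.update (fun _ : Fin (n + 1) => corner (side n) s) 0 (phi (side n) s 1 1) i =
      guardPt n s := by
    rw [update_sum_eq]; simp [guardPt]
  refine coeff_prod_onesPoly_eq_one (Tfam n) _ _ (fun i => ?_) hrepr fun f hf hsum => ?_
  · rcases eq_or_ne i 0 with rfl | hne
    · simp only [Function.update_self]
      have : phi (side n) s (cX n 0) (cY n 0) ∈ Tfam n 0 := phi_mem_Tgen _ _ _ s
      simpa [cX, cY] using this
    · rw [Function.update_of_ne hne]; exact corner_mem_Tgen _ _ _ s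
  · have hℓ : 1 ≤ n + 1 := by omega
    refine rep_guard_unique hℓ (Tfam n) (corner (side n) s) (phi (side n) s 1 1) (xi0 s 1 1) (xi1 s 1 1) 2
      (by norm_num) ?_ (fun i t ht hc hg => ?_) 0 (fun i hi => guard_only_zero n s i hi) f hf ?_
    · rw [fv_sub_eq_cval, cval_guard]
    · rw [fv_sub_eq_cval]; exact cval_gt_two n s i t ht hc hg
    · rw [hsum]; simp [guardPt]

/-- **Support of `F`**: the sumset minus the six deleted points. -/
theorem mem_support_desF (n : ℕ) (e : Fin 2 →₀ ℕ) :
    e ∈ (desF n).support ↔ e ∈ sumset (Tfam n) ∧ e ∉ Dels n := by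
  rw [mem_support_iff, desF, coeff_sub, coeff_onesPoly]
  by_cases he : e ∈ Dels n
  · rw [if_pos he]
    simp only [he, not_true_eq_false, and_false, iff_false, ne_eq, not_not]
    obtain ⟨s, h | h⟩ := (mem_Dels_iff n e).mp he
    · rw [h, coeff_desP_summitPt, sub_self]
    · rw [h, coeff_desP_guardPt, sub_self]
  · rw [if_neg he, sub_zero, ← mem_support_iff, desP, support_prod_onesPoly]
    simp [he]

/-- `F.support` as a finset. -/
theorem support_desF (n : ℕ) : (desF n).support = sumset (Tfam n) \ Dels n := by
  ext e; rw [mem_support_desF, Finset.mem_sdiff]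

/-! ## C.6 The lower bound `vert F ≥ n` (corner `0` alone suffices) -/

/-- The chain targets at corner `0` are `pt (X_j) (Y_j)`. -/
theorem targetPt_zero (n : ℕ) (j : Fin (n + 1)) : targetPt n 0 j = pt (cX n j) (cY n j) := by
  simp [targetPt, corner, phi, nsmul_pt, pt_add]

/-- The chain targets at corner `0` are not deleted. -/
theorem targetPt_zero_not_mem_Dels (n : ℕ) (j : Fin (n + 1)) (hj : (j : ℕ) ≠ 0) : targetPt n 0 j ∉ Dels n := by
  have hX := one_le_cX n j
  have hY := two_le_cY n j hj
  have hXY := cXY_le_side n j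
  intro h
  rw [targetPt_zero, mem_Dels_iff] at h
  obtain ⟨s, h | h⟩ := h <;> fin_cases s <;>
    simp [summitPt, guardPt, corner, phi, nsmul_pt, pt_add] at h <;>
    obtain ⟨h1, h2⟩ := pt_inj h <;> omega

/-- The chain targets lie in the sumset. -/
theorem targetPt_mem_sumset (n : ℕ) (s : Fin 3) (j : Fin (n + 1)) : targetPt n s j ∈ sumset (Tfam n) := by
  have h := devPoint_mem_sumset (Tfam n) (corner (side n) s) (phi (side n) s (cX n j) (cY n j))
    (fun i => corner_mem_Tgen _ _ _ s) j (phi_mem_Tgen _ _ _ s)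
  simpa [targetPt] using h

/-- **Exposure of the chain targets** at corner `0`: each is the unique minimiser over `supp F` of the form with
weights `(2j+1, 2n-2j+1)`. -/
theorem isUniqueMin_targetPt (n : ℕ) (j : Fin (n + 1)) (hj : (j : ℕ) ≠ 0) :
    IsUniqueMin (xi0 0 (2 * (j : ℝ) + 1) (2 * (n : ℝ) - 2 * j + 1)) (xi1 0 (2 * (j : ℝ) + 1) (2 * (n : ℝ) - 2 * j + 1))
      (desF n).support (targetPt n 0 j) := by
  set A : ℝ := 2 * (j : ℝ) + 1 with hAdef
  set B : ℝ := 2 * (n : ℝ) - 2 * j + 1 with hBdef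
  have hjn : (j : ℕ) ≤ n := Nat.lt_succ_iff.mp j.isLt
  have hjr : (j : ℝ) ≤ n := by exact_mod_cast hjn
  have hj0 : (0 : ℝ) ≤ j := by positivity
  have hA : (1 : ℝ) ≤ A := by rw [hAdef]; linarith
  have hB : (1 : ℝ) ≤ B := by rw [hBdef]; linarith
  refine ⟨(mem_support_desF n _).mpr ⟨targetPt_mem_sumset n 0 j, targetPt_zero_not_mem_Dels n j hj⟩,
    fun e he hne => ?_⟩
  obtain ⟨heS, heD⟩ := (mem_support_desF n e).mp he
  have hℓ : 1 ≤ n + 1 := by omega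
  have h := target_lt_of_values hℓ (Tfam n) (corner (side n) 0) (phi (side n) 0 1 1)
    (phi (side n) 0 (cX n j) (cY n j)) (xi0 0 A B) (xi1 0 A B) (A * cX n j + B * cY n j)
    (by rw [fv_sub_eq_cval, cval_phi_self _ _ _ _ _ _ (cXY_le_side' n j)])
    (fun i t ht hne => by
      have := cval_pos n 0 A B hA hB i t ht hne
      rw [← fv_sub_eq_cval] at this; linarith)
    (fun i t ht hc hg hq => by rw [fv_sub_eq_cval]; exact cval_gt_target n 0 j hj i t ht hc hg hq)
    (fun i i' hi hi' => by rw [guard_only_zero n 0 i hi, guard_only_zero n 0 i' hi'])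
    e heS ?_ ?_ ?_
  · simpa [targetPt] using h
  · intro h'; exact heD (h' ▸ summitPt_mem_Dels n 0)
  · intro h'; apply heD; rw [h']; convert guardPt_mem_Dels n 0 using 1; simp [guardPt]
  · intro h'; apply hne; rw [h']; simp [targetPt]

/-- **Lower bound**: `F` has at least `n` hull vertices. -/
theorem le_vert_desF (n : ℕ) : n ≤ vert (desF n) := by
  classical
  set W := (Finset.univ.erase (0 : Fin (n + 1))).image (targetPt n 0) with hW
  have hinj : Set.InjOn (targetPt n 0) ↑(Finset.univ.erase (0 : Fin (n + 1))) := by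
    intro j hj j' hj' h
    have hj0 : (j : ℕ) ≠ 0 := fun h0 => (Finset.ne_of_mem_erase (Finset.mem_coe.mp hj)) (Fin.ext h0)
    have hj0' : (j' : ℕ) ≠ 0 := fun h0 => (Finset.ne_of_mem_erase (Finset.mem_coe.mp hj')) (Fin.ext h0)
    rw [targetPt_zero, targetPt_zero] at h
    have h2 := (pt_inj h).2
    simp only [cY, if_neg hj0, if_neg hj0'] at h2
    exact Fin.ext (Nat.pow_left_injective two_ne_zero (by omega : (j : ℕ) ^ 2 = (j' : ℕ) ^ 2))
  have hcard : W.card = n := by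
    rw [hW, Finset.card_image_of_injOn hinj, Finset.card_erase_of_mem (Finset.mem_univ _), Finset.card_univ,
      Fintype.card_fin]; simp
  have key : W.card ≤ vert (desF n) := by
    refine card_le_vert (desF n) W fun e he => ?_
    rw [hW, Finset.mem_image] at he
    obtain ⟨j, hj, rfl⟩ := he
    have hj0 : (j : ℕ) ≠ 0 := fun h => (Finset.ne_of_mem_erase hj) (Fin.ext h)
    exact ⟨_, _, isUniqueMin_targetPt n j hj0⟩
  omega

end

end Summit.ValiantsHypothesis.ValiantsHypothesis.Theorems.NewtonTauWeak.Negative.AlignedPeelingCex
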